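import Literature.Computability.AlgebraicComplexity.LMR13PLambdaStabilizerBlockI
import Literature.Computability.AlgebraicComplexity.SkewAdjugateRankOne
import HarnessLib

/-!
# LMR13 §3.5, stabiliser of `P_Λ`: block (I) vanishes modulo its `n² − 1` functionals

[topic Computability/AlgebraicComplexity]

Landsberg–Manivel–Ressayre 2013, §3.5 (journal p. 481; arXiv:1004.4802 `p0008.txt:L82–88`) compute the
stabiliser `𝔤𝔩(W)_{P_Λ}` of `P_Λ(M) = (1/n)·tr(adj(M_skew)·M_sym)` block by block; its
`Hom(Λ², S²) = 𝔰𝔩_n ⊕ EAS`-component is `𝔰𝔩_n` (the maps `A ↦ ZA − AZᵀ`), of dimension `n² − 1`. In the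
cell's elementary route (`HOME/lmr/X3b-ELEMENTARY-ROUTE-t10g4.md` §4; `pLambda_glAnn_blocks`,
`LMR13PLambdaStabilizerSplit.lean`) this component is governed by the identity
(I) `tr(adj(A)·(L_X A)_sym) = 0` for all skew `A`, and the UPPER BOUND `dim ≤ n² − 1` is what the
assembly `SkewAdj.LMR2013_prop_3_5_1_of_blocks` (`LMR13PLambdaStabilizerAssembly.lean`, hypothesis
`blockI`) consumes. This file PROVES that hypothesis (`symPart_linAct_skew_eq_zero`, packaged verbatim as
`pLambda_blockI`): if `X ∈ 𝔤𝔩(W)_{P_Λ}` (`n = h+h+1`) and the `n(n−1) + (n−1)` linear functionals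
`f_{ab}(X) = (L_X W_{ab})_{bb}` (`a ≠ b`) and `g_j(X) = (L_X W_{0j})_{0j} + (L_X W_{0j})_{j0}` (`j ≠ 0`)
vanish (`W_{ab} := E_{ab} − E_{ba}`, `L_X M := (∑_p X_{p,(k,l)} M_p)_{kl}`), then `(L_X A)_sym = 0` for
every skew `A`.

Architecture (the memo's four test families compressed into ONE identity). The corank-one test points
`A(Ω,y) := R_r(Ω) + e_r ∧ (R_r(Ω)·y)` (`y_r = 1`) have `adj A(Ω,y) = det(Ω)·y yᵀ`
(`adjugate_padAt_add_wedge`, `SkewAdjugateRankOne.lean`), so (I) there reads `yᵀ(L_X A(Ω,y))y = 0`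
(`dotProduct_linAct_mulVec_eq_zero_of_adjugate_eq`); since `Ω ↦ A(Ω,y)` is linear
(`padAt_add_wedge_add_smul`), the difference of this identity at the signed matching matrices `J(π,s)` and
`J(π,s')` (`π a = b`, `s'` bumped on `{a,b}`; `SkewPairingMatrices.lean`) is `s_a` times
**(★) `yᵀ · L_X(W_{ab} + y_b·W_{ra} − y_a·W_{rb}) · y = 0`** for all distinct `r, a, b` and all `y` with
`y_r = 1` (`dotProduct_linAct_wedgeTest_mulVec_eq_zero`). The test vectors `y = e_r` (T1, t10's
`linAct_wedge_apply_self_eq_zero`, imported), `e_r + e_s` (T2,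
`linAct_wedge_apply_add_apply_eq_zero_of_disjoint`), `e_a ± e_s` (T3, `linAct_wedge_apply_add_apply_eq_neg`)
and `e_a + e_q + e_r` (T4, the cocycle `linAct_wedge_cocycle_of_f`) then kill, modulo `f` and `g`, every
symmetrised entry of every `L_X W_{ab}` (`linAct_wedge_apply_add_apply_eq_zero`), and a skew `A` is a
combination of the `W_{ab}`. No case distinction on `n` is needed (for `n = 3` the family T2 is vacuous).

Everything is PROVED; theorems only; no definitions, no named facts, no instances. Honest framing: one of
the two block hypotheses of the (X3b) assembly; `LMR2013_prop_3_5_1` remains OPEN in the tree until block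
(III) lands as well; VP ≠ VNP is NOT proved and nothing here is progress on it.

## References

* [LandsbergManivelRessayre2013] J. M. Landsberg, L. Manivel, N. Ressayre, *Hypersurfaces with degenerate
  duals and the geometric complexity theory program*, Comment. Math. Helv. 88 (2013) 469–484, §3.5 (p. 481).
-/

noncomputable section

open Matrix

namespace Literature.Computability.AlgebraicComplexity

namespace SkewAdj

variable {h : ℕ}

/-! ### The quadratic form of `L_X A` and the block-(I) identity at a rank-one adjugate -/

/-- Entries of `L_X (E_{ab} − E_{ba})`: `(L_X(E_ab − E_ba))_{kl} = X_{(a,b),(k,l)} − X_{(b,a),(k,l)}`.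
[cite: LandsbergManivelRessayre2013, §3.5 (p. 481)] -/
theorem linAct_wedge_apply {m : ℕ} (X : Matrix (Fin m × Fin m) (Fin m × Fin m) ℂ) (a b k l : Fin m) :
    (Matrix.of fun k l => ∑ p : Fin m × Fin m, X p (k, l) *
      (Matrix.single a b (1 : ℂ) - Matrix.single b a (1 : ℂ)) p.1 p.2) k l =
      X (a, b) (k, l) - X (b, a) (k, l) := by
  rw [linAct_sub, Matrix.sub_apply, Matrix.of_apply, Matrix.of_apply,
    Fintype.sum_eq_single (a, b) (fun p hp => by
      rw [Matrix.single_apply_of_ne (h := fun hh => hp (Prod.ext hh.1.symm hh.2.symm)), mul_zero]),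
    Fintype.sum_eq_single (b, a) (fun p hp => by
      rw [Matrix.single_apply_of_ne (h := fun hh => hp (Prod.ext hh.1.symm hh.2.symm)), mul_zero]),
    Matrix.single_apply_same, Matrix.single_apply_same, mul_one, mul_one]

/-- The quadratic form `y ↦ yᵀ(L_X A)y` is linear in `A`. [cite: LandsbergManivelRessayre2013, §3.5 (p. 481)] -/
theorem dotProduct_linAct_add_smul_mulVec {m : ℕ} (X : Matrix (Fin m × Fin m) (Fin m × Fin m) ℂ)
    (A B : Matrix (Fin m) (Fin m) ℂ) (c : ℂ) (y : Fin m → ℂ) :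
    y ⬝ᵥ ((Matrix.of fun k l => ∑ p : Fin m × Fin m, X p (k, l) * (A + c • B) p.1 p.2) *ᵥ y) =
      y ⬝ᵥ ((Matrix.of fun k l => ∑ p : Fin m × Fin m, X p (k, l) * A p.1 p.2) *ᵥ y) +
        c * (y ⬝ᵥ ((Matrix.of fun k l => ∑ p : Fin m × Fin m, X p (k, l) * B p.1 p.2) *ᵥ y)) := by
  rw [linAct_add_smul, Matrix.add_mulVec, Matrix.smul_mulVec, dotProduct_add, dotProduct_smul,
    smul_eq_mul]

/-- **Block (I) at a skew point with rank-one adjugate.** For `X ∈ 𝔤𝔩(W)_{P_Λ}` (`n = h+h+1`) and a skew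
`A` with `adj(A) = c·y yᵀ`, `c ≠ 0`, the block-(I) identity `tr(adj(A)·(L_X A)_sym) = 0`
(`pLambda_glAnn_blocks`) reads `yᵀ (L_X A) y = 0`. [cite: LandsbergManivelRessayre2013, §3.5 (p. 481)] -/
theorem dotProduct_linAct_mulVec_eq_zero_of_adjugate_eq
    {X : Matrix (Fin (h + h + 1) × Fin (h + h + 1)) (Fin (h + h + 1) × Fin (h + h + 1)) ℂ}
    (hX : X ∈ glAnn (pLambda (h + h + 1))) {A : Matrix (Fin (h + h + 1)) (Fin (h + h + 1)) ℂ}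
    (hA : Aᵀ = -A) {c : ℂ} (hc : c ≠ 0) {y : Fin (h + h + 1) → ℂ} (hadj : A.adjugate = c • vecMulVec y y) :
    y ⬝ᵥ ((Matrix.of fun k l => ∑ p : Fin (h + h + 1) × Fin (h + h + 1), X p (k, l) * A p.1 p.2) *ᵥ y) = 0 := by
  have h1 := (pLambda_glAnn_blocks (Nat.succ_ne_zero (h + h)) hX hA
    (show (0 : Matrix (Fin (h + h + 1)) (Fin (h + h + 1)) ℂ)ᵀ = 0 from Matrix.transpose_zero)).1
  set L := (Matrix.of fun k l => ∑ p : Fin (h + h + 1) × Fin (h + h + 1), X p (k, l) * A p.1 p.2) with hL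
  rw [hadj, Matrix.smul_mul, Matrix.trace_smul, vecMulVec_mul, trace_vecMulVec, smul_eq_mul, mul_eq_zero,
    Matrix.vecMul_smul, dotProduct_smul, smul_eq_mul, mul_eq_zero, Matrix.vecMul_add, vecMul_transpose,
    dotProduct_add] at h1
  rcases h1 with h1 | h1 | h1
  · exact absurd h1 hc
  · norm_num at h1
  · rw [dotProduct_comm y (y ᵥ* L), ← dotProduct_mulVec] at h1
    linear_combination h1 / 2

/-! ### The test points `A(Ω,y) = R_r(Ω) + e_r ∧ (R_r(Ω)·y)` -/

/-- The test point is linear in `Ω`: bumping the weights of `J(π,s)` on the pair `{a, πa}` changes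
`A(J(π,s), y)` by `s_a · A(E_{a,πa} − E_{πa,a}, y)`. [cite: LandsbergManivelRessayre2013, §3.5 (p. 481)] -/
theorem padAt_add_wedge_add_smul {m : ℕ} (r : Fin (m + 1)) (Ω W : Matrix (Fin m) (Fin m) ℂ) (c : ℂ)
    (y : Fin (m + 1) → ℂ) :
    padAt r (Ω + c • W) + (vecMulVec (Pi.single r 1) (padAt r (Ω + c • W) *ᵥ y) -
        vecMulVec (padAt r (Ω + c • W) *ᵥ y) (Pi.single r 1)) =
      (padAt r Ω + (vecMulVec (Pi.single r 1) (padAt r Ω *ᵥ y) - vecMulVec (padAt r Ω *ᵥ y) (Pi.single r 1))) +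
        c • (padAt r W + (vecMulVec (Pi.single r 1) (padAt r W *ᵥ y) -
          vecMulVec (padAt r W *ᵥ y) (Pi.single r 1))) := by
  have hP : padAt r (Ω + c • W) = padAt r Ω + c • padAt r W := by
    have h0 := padAt_sub r (Ω + c • W) Ω
    rw [add_sub_cancel_left, padAt_smul] at h0
    rw [h0, add_sub_cancel]
  rw [hP, Matrix.add_mulVec, Matrix.smul_mulVec, vecMulVec_add, vecMulVec_smul, add_vecMulVec, smul_vecMulVec,
    smul_add, smul_sub]
  abel

/-- `(c e_i)(d e_j)ᵀ = cd·E_{ij}`. [cite: LandsbergManivelRessayre2013, §3.5 (p. 481)] -/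
theorem vecMulVec_single_single {n : ℕ} (i j : Fin n) (c d : ℂ) :
    vecMulVec (Pi.single i c) (Pi.single j d) = Matrix.single i j (c * d) := by
  ext a b
  simp only [vecMulVec_apply, Pi.single_apply, Matrix.single_apply]
  aesop

/-- `(E_{ab} − E_{ba})·y = y_b e_a − y_a e_b`. [cite: LandsbergManivelRessayre2013, §3.5 (p. 481)] -/
theorem wedge_mulVec {n : ℕ} (a b : Fin n) (y : Fin n → ℂ) :
    (Matrix.single a b (1 : ℂ) - Matrix.single b a (1 : ℂ)) *ᵥ y = Pi.single a (y b) - Pi.single b (y a) := by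
  rw [Matrix.sub_mulVec, Matrix.single_mulVec, Matrix.single_mulVec, one_mul, one_mul]
  rfl

/-- `e_r ∧ ((E_{ab} − E_{ba})·y) = y_b·(E_{ra} − E_{ar}) − y_a·(E_{rb} − E_{br})`.
[cite: LandsbergManivelRessayre2013, §3.5 (p. 481)] -/
theorem vecMulVec_single_wedge_mulVec {n : ℕ} (r a b : Fin n) (y : Fin n → ℂ) :
    vecMulVec (Pi.single r 1) ((Matrix.single a b (1 : ℂ) - Matrix.single b a (1 : ℂ)) *ᵥ y) -
        vecMulVec ((Matrix.single a b (1 : ℂ) - Matrix.single b a (1 : ℂ)) *ᵥ y) (Pi.single r 1) =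
      y b • (Matrix.single r a (1 : ℂ) - Matrix.single a r (1 : ℂ)) -
        y a • (Matrix.single r b (1 : ℂ) - Matrix.single b r (1 : ℂ)) := by
  rw [wedge_mulVec, vecMulVec_sub, sub_vecMulVec, vecMulVec_single_single, vecMulVec_single_single,
    vecMulVec_single_single, vecMulVec_single_single, one_mul, one_mul, mul_one, mul_one, smul_sub, smul_sub,
    Matrix.smul_single, Matrix.smul_single, Matrix.smul_single, Matrix.smul_single, smul_eq_mul, mul_one,
    smul_eq_mul, mul_one]
  abel

/-- **The wedge test identity of block (I)** (all four test families of the cell memo at once). For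
`X ∈ 𝔤𝔩(W)_{P_Λ}`, `n = h+h+1`, an index `r`, distinct `a, b` among the indices `≠ r` (`A = r.succAbove a`,
`B = r.succAbove b`) and every `y` with `y_r = 1`:
`yᵀ · L_X(W_{AB} + y_B·W_{rA} − y_A·W_{rB}) · y = 0`, `W_{uv} := E_{uv} − E_{vu}`.
Proof: block (I) at the test points `A(J(π,s),y)` and `A(J(π,s'),y)` (`π a = b`, `s'` bumped on `{a,b}`,
`adj A(Ω,y) = detΩ·yyᵀ`), whose difference is `s_a·A(W_{ab},y)` by linearity of `Ω ↦ A(Ω,y)`.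
[cite: LandsbergManivelRessayre2013, §3.5 (p. 481)] -/
theorem dotProduct_linAct_wedgeTest_mulVec_eq_zero
    {X : Matrix (Fin (h + h + 1) × Fin (h + h + 1)) (Fin (h + h + 1) × Fin (h + h + 1)) ℂ}
    (hX : X ∈ glAnn (pLambda (h + h + 1))) (r : Fin (h + h + 1)) {a b : Fin (h + h)} (hab : a ≠ b)
    {y : Fin (h + h + 1) → ℂ} (hy : y r = 1) :
    y ⬝ᵥ ((Matrix.of fun k l => ∑ p : Fin (h + h + 1) × Fin (h + h + 1), X p (k, l) *
      ((Matrix.single (r.succAbove a) (r.succAbove b) (1 : ℂ) - Matrix.single (r.succAbove b) (r.succAbove a) 1 +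
        (y (r.succAbove b) • (Matrix.single r (r.succAbove a) (1 : ℂ) - Matrix.single (r.succAbove a) r 1) -
          y (r.succAbove a) • (Matrix.single r (r.succAbove b) (1 : ℂ) - Matrix.single (r.succAbove b) r 1)) :
            Matrix (Fin (h + h + 1)) (Fin (h + h + 1)) ℂ) p.1 p.2)) *ᵥ y) = 0 := by
  obtain ⟨π, hπ, hfix, hπa⟩ := exists_involution_apply_eq hab
  set s : Fin (h + h) → ℂ := fun x => if x < π x then (1 : ℂ) else -1 with hs_def
  have hs : ∀ x, s (π x) = -s x := fun x => signWeight_antisymm hπ hfix x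
  have hs0 : ∀ x, s x ≠ 0 := fun x => signWeight_ne_zero π x
  -- block (I) at the test point `A(J(π,w), y)` for admissible weights `w`
  have key : ∀ w : Fin (h + h) → ℂ, (∀ x, w (π x) = -w x) → (∀ x, w x ≠ 0) →
      y ⬝ᵥ ((Matrix.of fun k l => ∑ p : Fin (h + h + 1) × Fin (h + h + 1), X p (k, l) *
        (padAt r (pairMat π w) + (vecMulVec (Pi.single r 1) (padAt r (pairMat π w) *ᵥ y) -
          vecMulVec (padAt r (pairMat π w) *ᵥ y) (Pi.single r 1))) p.1 p.2) *ᵥ y) = 0 := by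
    intro w hw hw0
    have hΩ := pairMat_transpose hπ hw
    exact dotProduct_linAct_mulVec_eq_zero_of_adjugate_eq hX (transpose_padAt_add_wedge r hΩ y)
      (isUnit_det_pairMat hπ hw hw0).ne_zero (adjugate_padAt_add_wedge r hΩ y hy)
  have e1 := key s hs hs0
  have e2 := key (bumpWeight π s a) (bumpWeight_antisymm hπ hs a) (bumpWeight_ne_zero π hs0 a)
  have hΩ2 : pairMat π (bumpWeight π s a) =
      pairMat π s + s a • (Matrix.single a b (1 : ℂ) - Matrix.single b a (1 : ℂ)) := by
    rw [← hπa, ← pairMat_bumpWeight_sub hπ hfix hs a, add_sub_cancel]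
  rw [hΩ2, padAt_add_wedge_add_smul, dotProduct_linAct_add_smul_mulVec, e1, zero_add, mul_eq_zero] at e2
  have e3 := e2.resolve_left (hs0 a)
  rwa [padAt_sub, padAt_single, padAt_single, vecMulVec_single_wedge_mulVec] at e3

/-- `L_X` on the shape of the test matrices: `L_X(A + (c·B − d·C)) = L_X A + c·L_X B − d·L_X C`.
[cite: LandsbergManivelRessayre2013, §3.5 (p. 481)] -/
theorem linAct_add_smul_sub_smul {m : ℕ} (X : Matrix (Fin m × Fin m) (Fin m × Fin m) ℂ)
    (A B C : Matrix (Fin m) (Fin m) ℂ) (c d : ℂ) :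
    (Matrix.of fun k l => ∑ p : Fin m × Fin m, X p (k, l) * (A + (c • B - d • C)) p.1 p.2) =
      (Matrix.of fun k l => ∑ p : Fin m × Fin m, X p (k, l) * A p.1 p.2) +
        c • (Matrix.of fun k l => ∑ p : Fin m × Fin m, X p (k, l) * B p.1 p.2) -
          d • (Matrix.of fun k l => ∑ p : Fin m × Fin m, X p (k, l) * C p.1 p.2) := by
  rw [linAct_add, linAct_sub X (c • B) (d • C), linAct_smul, linAct_smul]
  abel

/-! ### Evaluating the quadratic form at sparse vectors -/

/-- `yᵀMy` at `y = e_r + t e_s`. [cite: LandsbergManivelRessayre2013, §3.5 (p. 481)] -/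
theorem quadForm_single_add_smul_single {n : ℕ} (M : Matrix (Fin n) (Fin n) ℂ) (r s : Fin n) (t : ℂ) :
    (Pi.single r 1 + t • Pi.single s 1) ⬝ᵥ (M *ᵥ (Pi.single r 1 + t • Pi.single s 1)) =
      M r r + t * (M r s + M s r) + t ^ 2 * M s s := by
  simp only [Matrix.mulVec_add, Matrix.mulVec_smul, Matrix.mulVec_single_one, add_dotProduct, dotProduct_add,
    dotProduct_smul, smul_dotProduct, single_dotProduct, smul_eq_mul, one_mul, Matrix.col_apply]
  ring

/-- `yᵀMy` at `y = e_p + e_q + e_r`. [cite: LandsbergManivelRessayre2013, §3.5 (p. 481)] -/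
theorem quadForm_single_add_single_add_single {n : ℕ} (M : Matrix (Fin n) (Fin n) ℂ) (p q r : Fin n) :
    (Pi.single p 1 + Pi.single q 1 + Pi.single r 1) ⬝ᵥ (M *ᵥ (Pi.single p 1 + Pi.single q 1 + Pi.single r 1)) =
      M p p + M p q + M p r + (M q p + M q q + M q r) + (M r p + M r q + M r r) := by
  simp only [Matrix.mulVec_add, Matrix.mulVec_single_one, add_dotProduct, dotProduct_add, single_dotProduct,
    one_mul, Matrix.col_apply]
  ring

/-! ### The wedge test identity in global indices, and the four test families -/

/-- The wedge test identity for pairwise distinct global indices `r, a, b` and `y` with `y_r = 1`: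
`yᵀ · L_X(W_{ab} + y_b·W_{ra} − y_a·W_{rb}) · y = 0`. [cite: LandsbergManivelRessayre2013, §3.5 (p. 481)] -/
theorem dotProduct_linAct_wedgeTest_mulVec_eq_zero'
    {X : Matrix (Fin (h + h + 1) × Fin (h + h + 1)) (Fin (h + h + 1) × Fin (h + h + 1)) ℂ}
    (hX : X ∈ glAnn (pLambda (h + h + 1))) {r a b : Fin (h + h + 1)} (har : a ≠ r) (hbr : b ≠ r) (hab : a ≠ b)
    {y : Fin (h + h + 1) → ℂ} (hy : y r = 1) :
    y ⬝ᵥ ((Matrix.of fun k l => ∑ p : Fin (h + h + 1) × Fin (h + h + 1), X p (k, l) *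
      ((Matrix.single a b (1 : ℂ) - Matrix.single b a 1 +
        (y b • (Matrix.single r a (1 : ℂ) - Matrix.single a r 1) -
          y a • (Matrix.single r b (1 : ℂ) - Matrix.single b r 1)) :
            Matrix (Fin (h + h + 1)) (Fin (h + h + 1)) ℂ) p.1 p.2)) *ᵥ y) = 0 := by
  obtain ⟨a', rfl⟩ := Fin.exists_succAbove_eq har
  obtain ⟨b', rfl⟩ := Fin.exists_succAbove_eq hbr
  exact dotProduct_linAct_wedgeTest_mulVec_eq_zero hX r (fun hh => hab (congrArg r.succAbove hh)) hy

/-- The entries of `L_X(W_{ab})` are antisymmetric in `(a,b)`. [cite: LandsbergManivelRessayre2013, §3.5 (p. 481)] -/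
theorem linAct_wedge_apply_swap {m : ℕ} (X : Matrix (Fin m × Fin m) (Fin m × Fin m) ℂ) (a b k l : Fin m) :
    (Matrix.of fun k l => ∑ p : Fin m × Fin m, X p (k, l) *
      (Matrix.single b a (1 : ℂ) - Matrix.single a b (1 : ℂ)) p.1 p.2) k l =
      -(Matrix.of fun k l => ∑ p : Fin m × Fin m, X p (k, l) *
        (Matrix.single a b (1 : ℂ) - Matrix.single b a (1 : ℂ)) p.1 p.2) k l := by
  rw [linAct_wedge_apply, linAct_wedge_apply, neg_sub]

/-- **T1 (global indices)**: `(L_X W_{ab})_{kk} = 0` for `k ∉ {a,b}` (t10's `linAct_wedge_apply_self_eq_zero`).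
[cite: LandsbergManivelRessayre2013, §3.5 (p. 481)] -/
theorem linAct_wedge_apply_diag_eq_zero
    {X : Matrix (Fin (h + h + 1) × Fin (h + h + 1)) (Fin (h + h + 1) × Fin (h + h + 1)) ℂ}
    (hX : X ∈ glAnn (pLambda (h + h + 1))) {a b k : Fin (h + h + 1)} (hab : a ≠ b) (hak : a ≠ k)
    (hbk : b ≠ k) :
    (Matrix.of fun k l => ∑ p : Fin (h + h + 1) × Fin (h + h + 1), X p (k, l) *
      (Matrix.single a b (1 : ℂ) - Matrix.single b a (1 : ℂ)) p.1 p.2) k k = 0 := by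
  obtain ⟨a', rfl⟩ := Fin.exists_succAbove_eq hak
  obtain ⟨b', rfl⟩ := Fin.exists_succAbove_eq hbk
  exact linAct_wedge_apply_self_eq_zero hX k (fun hh => hab (congrArg k.succAbove hh))

/-- **T2**: `(L_X W_{ab})_{rs} + (L_X W_{ab})_{sr} = 0` when `r ≠ s` and `{r,s} ∩ {a,b} = ∅` (test vector
`y = e_r + e_s`; vacuous for `n = 3`). [cite: LandsbergManivelRessayre2013, §3.5 (p. 481)] -/
theorem linAct_wedge_apply_add_apply_eq_zero_of_disjoint
    {X : Matrix (Fin (h + h + 1) × Fin (h + h + 1)) (Fin (h + h + 1) × Fin (h + h + 1)) ℂ}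
    (hX : X ∈ glAnn (pLambda (h + h + 1))) {a b r s : Fin (h + h + 1)} (hab : a ≠ b) (har : a ≠ r)
    (hbr : b ≠ r) (has : a ≠ s) (hbs : b ≠ s) (hrs : r ≠ s) :
    (Matrix.of fun k l => ∑ p : Fin (h + h + 1) × Fin (h + h + 1), X p (k, l) *
        (Matrix.single a b (1 : ℂ) - Matrix.single b a (1 : ℂ)) p.1 p.2) r s +
      (Matrix.of fun k l => ∑ p : Fin (h + h + 1) × Fin (h + h + 1), X p (k, l) *
        (Matrix.single a b (1 : ℂ) - Matrix.single b a (1 : ℂ)) p.1 p.2) s r = 0 := by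
  set y : Fin (h + h + 1) → ℂ := Pi.single r 1 + (1 : ℂ) • Pi.single s 1 with hy_def
  have hyr : y r = 1 := by simp [hy_def, hrs]
  have hya : y a = 0 := by simp [hy_def, har, has]
  have hyb : y b = 0 := by simp [hy_def, hbr, hbs]
  have e := dotProduct_linAct_wedgeTest_mulVec_eq_zero' hX har hbr hab hyr
  rw [hya, hyb, zero_smul, zero_smul, sub_zero, add_zero, hy_def, quadForm_single_add_smul_single,
    linAct_wedge_apply_diag_eq_zero hX hab har hbr, linAct_wedge_apply_diag_eq_zero hX hab has hbs] at e
  linear_combination e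

/-- **T3**: `(L_X W_{aq})_{as} + (L_X W_{aq})_{sa} = −(L_X W_{qs})_{ss}` for distinct `a, q, s` (test vectors
`y = e_a ± e_s` at the pair `{q,s}`, `t²`-coefficient). [cite: LandsbergManivelRessayre2013, §3.5 (p. 481)] -/
theorem linAct_wedge_apply_add_apply_eq_neg
    {X : Matrix (Fin (h + h + 1) × Fin (h + h + 1)) (Fin (h + h + 1) × Fin (h + h + 1)) ℂ}
    (hX : X ∈ glAnn (pLambda (h + h + 1))) {a q s : Fin (h + h + 1)} (haq : a ≠ q) (has : a ≠ s)
    (hqs : q ≠ s) :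
    (Matrix.of fun k l => ∑ p : Fin (h + h + 1) × Fin (h + h + 1), X p (k, l) *
        (Matrix.single a q (1 : ℂ) - Matrix.single q a (1 : ℂ)) p.1 p.2) a s +
      (Matrix.of fun k l => ∑ p : Fin (h + h + 1) × Fin (h + h + 1), X p (k, l) *
        (Matrix.single a q (1 : ℂ) - Matrix.single q a (1 : ℂ)) p.1 p.2) s a =
      -(Matrix.of fun k l => ∑ p : Fin (h + h + 1) × Fin (h + h + 1), X p (k, l) *
        (Matrix.single q s (1 : ℂ) - Matrix.single s q (1 : ℂ)) p.1 p.2) s s := by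
  -- the two test vectors `e_a + t e_s`, `t = ±1`, at base `a` and pair `{q, s}`
  have key : ∀ t : ℂ, t * t = 1 →
      (Matrix.of fun k l => ∑ p : Fin (h + h + 1) × Fin (h + h + 1), X p (k, l) *
          (Matrix.single q s (1 : ℂ) - Matrix.single s q (1 : ℂ)) p.1 p.2) a a +
        t * ((Matrix.of fun k l => ∑ p : Fin (h + h + 1) × Fin (h + h + 1), X p (k, l) *
            (Matrix.single q s (1 : ℂ) - Matrix.single s q (1 : ℂ)) p.1 p.2) a s +
          (Matrix.of fun k l => ∑ p : Fin (h + h + 1) × Fin (h + h + 1), X p (k, l) *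
            (Matrix.single q s (1 : ℂ) - Matrix.single s q (1 : ℂ)) p.1 p.2) s a) +
        t ^ 2 * (Matrix.of fun k l => ∑ p : Fin (h + h + 1) × Fin (h + h + 1), X p (k, l) *
            (Matrix.single q s (1 : ℂ) - Matrix.single s q (1 : ℂ)) p.1 p.2) s s +
      t * ((Matrix.of fun k l => ∑ p : Fin (h + h + 1) × Fin (h + h + 1), X p (k, l) *
          (Matrix.single a q (1 : ℂ) - Matrix.single q a (1 : ℂ)) p.1 p.2) a a +
        t * ((Matrix.of fun k l => ∑ p : Fin (h + h + 1) × Fin (h + h + 1), X p (k, l) *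
            (Matrix.single a q (1 : ℂ) - Matrix.single q a (1 : ℂ)) p.1 p.2) a s +
          (Matrix.of fun k l => ∑ p : Fin (h + h + 1) × Fin (h + h + 1), X p (k, l) *
            (Matrix.single a q (1 : ℂ) - Matrix.single q a (1 : ℂ)) p.1 p.2) s a) +
        t ^ 2 * (Matrix.of fun k l => ∑ p : Fin (h + h + 1) × Fin (h + h + 1), X p (k, l) *
            (Matrix.single a q (1 : ℂ) - Matrix.single q a (1 : ℂ)) p.1 p.2) s s) = 0 := by
    intro t ht
    set y : Fin (h + h + 1) → ℂ := Pi.single a 1 + t • Pi.single s 1 with hy_def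
    have hya : y a = 1 := by simp [hy_def, has.symm]
    have hyq : y q = 0 := by simp [hy_def, haq.symm, hqs]
    have hys : y s = t := by simp [hy_def, has]
    have e := dotProduct_linAct_wedgeTest_mulVec_eq_zero' hX haq.symm has.symm hqs hya
    rw [hyq, hys, zero_smul, sub_zero, dotProduct_linAct_add_smul_mulVec, hy_def,
      quadForm_single_add_smul_single, quadForm_single_add_smul_single] at e
    exact e
  have e1 := key 1 (by norm_num)
  have e2 := key (-1) (by norm_num)
  have z1 := linAct_wedge_apply_diag_eq_zero hX hqs (Ne.symm haq) (Ne.symm has)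
  have z2 := linAct_wedge_apply_diag_eq_zero hX haq has hqs
  rw [z1, z2] at e1 e2
  linear_combination (e1 + e2) / 2

/-! ### Consequences modulo the diagonal functionals `f_{ab} = (L_X W_{ab})_{bb}` -/

/-- Modulo the functionals `f`, every diagonal entry of `L_X W_{ab}` vanishes (T1 off `{a,b}`, `f` on it).
[cite: LandsbergManivelRessayre2013, §3.5 (p. 481)] -/
theorem linAct_wedge_apply_diag_eq_zero_of_f
    {X : Matrix (Fin (h + h + 1) × Fin (h + h + 1)) (Fin (h + h + 1) × Fin (h + h + 1)) ℂ}
    (hX : X ∈ glAnn (pLambda (h + h + 1)))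
    (hf : ∀ a b : Fin (h + h + 1), a ≠ b →
      (Matrix.of fun k l => ∑ p : Fin (h + h + 1) × Fin (h + h + 1), X p (k, l) *
        (Matrix.single a b (1 : ℂ) - Matrix.single b a (1 : ℂ)) p.1 p.2) b b = 0)
    {a b : Fin (h + h + 1)} (hab : a ≠ b) (k : Fin (h + h + 1)) :
    (Matrix.of fun k l => ∑ p : Fin (h + h + 1) × Fin (h + h + 1), X p (k, l) *
        (Matrix.single a b (1 : ℂ) - Matrix.single b a (1 : ℂ)) p.1 p.2) k k = 0 := by
  by_cases hak : a = k
  · subst hak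
    have e := hf b a (Ne.symm hab)
    rwa [linAct_wedge_apply_swap, neg_eq_zero] at e
  · by_cases hbk : b = k
    · subst hbk
      exact hf a b hab
    · exact linAct_wedge_apply_diag_eq_zero hX hab hak hbk

/-- Modulo the functionals `f`, the symmetrised entry `(k,l)`, `k ≠ l`, `{k,l} ≠ {a,b}`, of `L_X W_{ab}`
vanishes (T2 off `{a,b}`, T3 + `f` on the rows/columns `a`, `b`). [cite: LandsbergManivelRessayre2013, §3.5 (p. 481)] -/
theorem linAct_wedge_apply_add_apply_eq_zero_of_f
    {X : Matrix (Fin (h + h + 1) × Fin (h + h + 1)) (Fin (h + h + 1) × Fin (h + h + 1)) ℂ}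
    (hX : X ∈ glAnn (pLambda (h + h + 1)))
    (hf : ∀ a b : Fin (h + h + 1), a ≠ b →
      (Matrix.of fun k l => ∑ p : Fin (h + h + 1) × Fin (h + h + 1), X p (k, l) *
        (Matrix.single a b (1 : ℂ) - Matrix.single b a (1 : ℂ)) p.1 p.2) b b = 0)
    {a b k l : Fin (h + h + 1)} (hab : a ≠ b) (hkl : k ≠ l) (h₁ : ¬(k = a ∧ l = b)) (h₂ : ¬(k = b ∧ l = a)) :
    (Matrix.of fun k l => ∑ p : Fin (h + h + 1) × Fin (h + h + 1), X p (k, l) *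
        (Matrix.single a b (1 : ℂ) - Matrix.single b a (1 : ℂ)) p.1 p.2) k l +
      (Matrix.of fun k l => ∑ p : Fin (h + h + 1) × Fin (h + h + 1), X p (k, l) *
        (Matrix.single a b (1 : ℂ) - Matrix.single b a (1 : ℂ)) p.1 p.2) l k = 0 := by
  by_cases hka : k = a
  · subst hka
    have hlb : l ≠ b := fun hh => h₁ ⟨rfl, hh⟩
    rw [linAct_wedge_apply_add_apply_eq_neg hX hab hkl (Ne.symm hlb), hf b l (Ne.symm hlb), neg_zero]
  · by_cases hkb : k = b
    · subst hkb
      have hla : l ≠ a := fun hh => h₂ ⟨rfl, hh⟩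
      rw [← neg_eq_zero, neg_add, ← linAct_wedge_apply_swap, ← linAct_wedge_apply_swap,
        linAct_wedge_apply_add_apply_eq_neg hX (Ne.symm hab) hkl (Ne.symm hla), hf a l (Ne.symm hla), neg_zero]
    · by_cases hla : l = a
      · subst hla
        rw [add_comm, linAct_wedge_apply_add_apply_eq_neg hX hab (Ne.symm hkl) (Ne.symm hkb), hf b k (Ne.symm hkb),
          neg_zero]
      · by_cases hlb : l = b
        · subst hlb
          rw [← neg_eq_zero, neg_add, ← linAct_wedge_apply_swap, ← linAct_wedge_apply_swap, add_comm,
            linAct_wedge_apply_add_apply_eq_neg hX (Ne.symm hab) (Ne.symm hkl) (Ne.symm hka), hf a k (Ne.symm hka),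
            neg_zero]
        · exact linAct_wedge_apply_add_apply_eq_zero_of_disjoint hX hab (Ne.symm hka) (Ne.symm hkb) (Ne.symm hla)
            (Ne.symm hlb) hkl

/-- **T4, the cocycle relation** (modulo `f`): `c_{aq} + c_{qr} = c_{ar}` for distinct `a, q, r`, where
`c_{uv} := (L_X W_{uv})_{uv} + (L_X W_{uv})_{vu}` (test vector `y = e_a + e_q + e_r` at base `a`, pair `{q,r}`).
[cite: LandsbergManivelRessayre2013, §3.5 (p. 481)] -/
theorem linAct_wedge_cocycle_of_f
    {X : Matrix (Fin (h + h + 1) × Fin (h + h + 1)) (Fin (h + h + 1) × Fin (h + h + 1)) ℂ}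
    (hX : X ∈ glAnn (pLambda (h + h + 1)))
    (hf : ∀ a b : Fin (h + h + 1), a ≠ b →
      (Matrix.of fun k l => ∑ p : Fin (h + h + 1) × Fin (h + h + 1), X p (k, l) *
        (Matrix.single a b (1 : ℂ) - Matrix.single b a (1 : ℂ)) p.1 p.2) b b = 0)
    {a q r : Fin (h + h + 1)} (haq : a ≠ q) (har : a ≠ r) (hqr : q ≠ r) :
    (Matrix.of fun k l => ∑ p : Fin (h + h + 1) × Fin (h + h + 1), X p (k, l) *
        (Matrix.single a q (1 : ℂ) - Matrix.single q a (1 : ℂ)) p.1 p.2) a q +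
        (Matrix.of fun k l => ∑ p : Fin (h + h + 1) × Fin (h + h + 1), X p (k, l) *
        (Matrix.single a q (1 : ℂ) - Matrix.single q a (1 : ℂ)) p.1 p.2) q a +
      ((Matrix.of fun k l => ∑ p : Fin (h + h + 1) × Fin (h + h + 1), X p (k, l) *
        (Matrix.single q r (1 : ℂ) - Matrix.single r q (1 : ℂ)) p.1 p.2) q r +
        (Matrix.of fun k l => ∑ p : Fin (h + h + 1) × Fin (h + h + 1), X p (k, l) *
        (Matrix.single q r (1 : ℂ) - Matrix.single r q (1 : ℂ)) p.1 p.2) r q) =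
      (Matrix.of fun k l => ∑ p : Fin (h + h + 1) × Fin (h + h + 1), X p (k, l) *
        (Matrix.single a r (1 : ℂ) - Matrix.single r a (1 : ℂ)) p.1 p.2) a r +
        (Matrix.of fun k l => ∑ p : Fin (h + h + 1) × Fin (h + h + 1), X p (k, l) *
        (Matrix.single a r (1 : ℂ) - Matrix.single r a (1 : ℂ)) p.1 p.2) r a := by
  set y : Fin (h + h + 1) → ℂ := Pi.single a 1 + Pi.single q 1 + Pi.single r 1 with hy_def
  have hya : y a = 1 := by simp [hy_def, haq, har]
  have hyq : y q = 1 := by simp [hy_def, haq.symm, hqr]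
  have hyr : y r = 1 := by simp [hy_def, har.symm, hqr.symm]
  have e := dotProduct_linAct_wedgeTest_mulVec_eq_zero' hX (Ne.symm haq) (Ne.symm har) hqr hya
  rw [hyq, hyr, linAct_add_smul_sub_smul, one_smul, one_smul, Matrix.sub_mulVec, Matrix.add_mulVec, dotProduct_sub,
    dotProduct_add, hy_def, quadForm_single_add_single_add_single, quadForm_single_add_single_add_single,
    quadForm_single_add_single_add_single] at e
  -- the vanishing entries (diagonals, and symmetrised entries off the wedge's own slot)
  have d11 := linAct_wedge_apply_diag_eq_zero_of_f hX hf hqr a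
  have d12 := linAct_wedge_apply_diag_eq_zero_of_f hX hf hqr q
  have d13 := linAct_wedge_apply_diag_eq_zero_of_f hX hf hqr r
  have s11 := linAct_wedge_apply_add_apply_eq_zero_of_f hX hf hqr haq (fun hh => haq hh.1) (fun hh => har hh.1)
  have s12 := linAct_wedge_apply_add_apply_eq_zero_of_f hX hf hqr har (fun hh => haq hh.1) (fun hh => hqr hh.2.symm)
  have d21 := linAct_wedge_apply_diag_eq_zero_of_f hX hf haq a
  have d22 := linAct_wedge_apply_diag_eq_zero_of_f hX hf haq q
  have d23 := linAct_wedge_apply_diag_eq_zero_of_f hX hf haq r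
  have s21 := linAct_wedge_apply_add_apply_eq_zero_of_f hX hf haq har (fun hh => hqr hh.2.symm) (fun hh => har hh.2.symm)
  have s22 := linAct_wedge_apply_add_apply_eq_zero_of_f hX hf haq hqr (fun hh => haq hh.1.symm) (fun hh => har hh.2.symm)
  have d31 := linAct_wedge_apply_diag_eq_zero_of_f hX hf har a
  have d32 := linAct_wedge_apply_diag_eq_zero_of_f hX hf har q
  have d33 := linAct_wedge_apply_diag_eq_zero_of_f hX hf har r
  have s31 := linAct_wedge_apply_add_apply_eq_zero_of_f hX hf har haq (fun hh => hqr hh.2) (fun hh => haq hh.2.symm)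
  have s32 := linAct_wedge_apply_add_apply_eq_zero_of_f hX hf har hqr (fun hh => haq hh.1.symm) (fun hh => hqr hh.1)
  linear_combination e - d11 - d12 - d13 - s11 - s12 - d21 - d22 - d23 - s21 - s22 + d31 + d32 + d33 + s31 + s32

/-! ### Block (I) vanishes modulo its `n² − 1` functionals -/

/-- Modulo `f` and `g_j = c_{0j}`: the wedge's own symmetrised entry `c_{ab}` vanishes (cocycle through `0`).
[cite: LandsbergManivelRessayre2013, §3.5 (p. 481)] -/
theorem linAct_wedge_apply_add_apply_self_eq_zero
    {X : Matrix (Fin (h + h + 1) × Fin (h + h + 1)) (Fin (h + h + 1) × Fin (h + h + 1)) ℂ}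
    (hX : X ∈ glAnn (pLambda (h + h + 1)))
    (hf : ∀ a b : Fin (h + h + 1), a ≠ b →
      (Matrix.of fun k l => ∑ p : Fin (h + h + 1) × Fin (h + h + 1), X p (k, l) *
        (Matrix.single a b (1 : ℂ) - Matrix.single b a (1 : ℂ)) p.1 p.2) b b = 0)
    (hg : ∀ j : Fin (h + h + 1), j ≠ 0 →
      (Matrix.of fun k l => ∑ p : Fin (h + h + 1) × Fin (h + h + 1), X p (k, l) *
          (Matrix.single (0 : Fin (h + h + 1)) j (1 : ℂ) - Matrix.single j (0 : Fin (h + h + 1)) (1 : ℂ)) p.1 p.2) 0 j +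
        (Matrix.of fun k l => ∑ p : Fin (h + h + 1) × Fin (h + h + 1), X p (k, l) *
          (Matrix.single (0 : Fin (h + h + 1)) j (1 : ℂ) - Matrix.single j (0 : Fin (h + h + 1)) (1 : ℂ)) p.1 p.2) j 0 = 0)
    {a b : Fin (h + h + 1)} (hab : a ≠ b) :
    (Matrix.of fun k l => ∑ p : Fin (h + h + 1) × Fin (h + h + 1), X p (k, l) *
        (Matrix.single a b (1 : ℂ) - Matrix.single b a (1 : ℂ)) p.1 p.2) a b +
      (Matrix.of fun k l => ∑ p : Fin (h + h + 1) × Fin (h + h + 1), X p (k, l) *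
        (Matrix.single a b (1 : ℂ) - Matrix.single b a (1 : ℂ)) p.1 p.2) b a = 0 := by
  by_cases ha0 : a = 0
  · subst ha0
    exact hg b (Ne.symm hab)
  · by_cases hb0 : b = 0
    · subst hb0
      rw [← neg_eq_zero, neg_add, ← linAct_wedge_apply_swap, ← linAct_wedge_apply_swap, add_comm]
      exact hg a ha0
    · have c := linAct_wedge_cocycle_of_f hX hf (Ne.symm ha0) (Ne.symm hb0) hab
      rw [hg a ha0, hg b hb0, zero_add] at c
      exact c

/-- Modulo `f` and `g`, EVERY symmetrised entry of every `L_X W_{ab}` vanishes.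
[cite: LandsbergManivelRessayre2013, §3.5 (p. 481)] -/
theorem linAct_wedge_apply_add_apply_eq_zero
    {X : Matrix (Fin (h + h + 1) × Fin (h + h + 1)) (Fin (h + h + 1) × Fin (h + h + 1)) ℂ}
    (hX : X ∈ glAnn (pLambda (h + h + 1)))
    (hf : ∀ a b : Fin (h + h + 1), a ≠ b →
      (Matrix.of fun k l => ∑ p : Fin (h + h + 1) × Fin (h + h + 1), X p (k, l) *
        (Matrix.single a b (1 : ℂ) - Matrix.single b a (1 : ℂ)) p.1 p.2) b b = 0)
    (hg : ∀ j : Fin (h + h + 1), j ≠ 0 →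
      (Matrix.of fun k l => ∑ p : Fin (h + h + 1) × Fin (h + h + 1), X p (k, l) *
          (Matrix.single (0 : Fin (h + h + 1)) j (1 : ℂ) - Matrix.single j (0 : Fin (h + h + 1)) (1 : ℂ)) p.1 p.2) 0 j +
        (Matrix.of fun k l => ∑ p : Fin (h + h + 1) × Fin (h + h + 1), X p (k, l) *
          (Matrix.single (0 : Fin (h + h + 1)) j (1 : ℂ) - Matrix.single j (0 : Fin (h + h + 1)) (1 : ℂ)) p.1 p.2) j 0 = 0)
    (a b k l : Fin (h + h + 1)) :
    (Matrix.of fun k l => ∑ p : Fin (h + h + 1) × Fin (h + h + 1), X p (k, l) *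
        (Matrix.single a b (1 : ℂ) - Matrix.single b a (1 : ℂ)) p.1 p.2) k l +
      (Matrix.of fun k l => ∑ p : Fin (h + h + 1) × Fin (h + h + 1), X p (k, l) *
        (Matrix.single a b (1 : ℂ) - Matrix.single b a (1 : ℂ)) p.1 p.2) l k = 0 := by
  by_cases hab : a = b
  · subst hab
    rw [linAct_wedge_apply, linAct_wedge_apply, sub_self, sub_self, add_zero]
  by_cases hkl : k = l
  · subst hkl
    rw [linAct_wedge_apply_diag_eq_zero_of_f hX hf hab k, add_zero]
  by_cases h₁ : k = a ∧ l = b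
  · obtain ⟨rfl, rfl⟩ := h₁
    exact linAct_wedge_apply_add_apply_self_eq_zero hX hf hg hab
  by_cases h₂ : k = b ∧ l = a
  · obtain ⟨rfl, rfl⟩ := h₂
    rw [add_comm]
    exact linAct_wedge_apply_add_apply_self_eq_zero hX hf hg hab
  exact linAct_wedge_apply_add_apply_eq_zero_of_f hX hf hab hkl h₁ h₂

/-- **Block (I) of the stabiliser of `P_Λ` vanishes modulo its `n² − 1` functionals** (LMR13 §3.5: the
`Hom(Λ², S²)`-component of `𝔤𝔩(W)_{P_Λ}` is `𝔰𝔩_n`, of dimension `n² − 1`; here in the elementary form of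
the cell memo §4): if `X ∈ 𝔤𝔩(W)_{P_Λ}` (`n = h+h+1`) and the `n(n−1) + (n−1)` linear functionals
`f_{ab}(X) = (L_X W_{ab})_{bb}` (`a ≠ b`) and `g_j(X) = (L_X W_{0j})_{0j} + (L_X W_{0j})_{j0}` (`j ≠ 0`) vanish
at `X`, then the symmetric part of `L_X A` vanishes for every skew `A`.
[cite: LandsbergManivelRessayre2013, §3.5 (p. 481)] -/
theorem symPart_linAct_skew_eq_zero
    {X : Matrix (Fin (h + h + 1) × Fin (h + h + 1)) (Fin (h + h + 1) × Fin (h + h + 1)) ℂ}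
    (hX : X ∈ glAnn (pLambda (h + h + 1)))
    (hf : ∀ a b : Fin (h + h + 1), a ≠ b →
      (Matrix.of fun k l => ∑ p : Fin (h + h + 1) × Fin (h + h + 1), X p (k, l) *
        (Matrix.single a b (1 : ℂ) - Matrix.single b a (1 : ℂ)) p.1 p.2) b b = 0)
    (hg : ∀ j : Fin (h + h + 1), j ≠ 0 →
      (Matrix.of fun k l => ∑ p : Fin (h + h + 1) × Fin (h + h + 1), X p (k, l) *
          (Matrix.single (0 : Fin (h + h + 1)) j (1 : ℂ) - Matrix.single j (0 : Fin (h + h + 1)) (1 : ℂ)) p.1 p.2) 0 j +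
        (Matrix.of fun k l => ∑ p : Fin (h + h + 1) × Fin (h + h + 1), X p (k, l) *
          (Matrix.single (0 : Fin (h + h + 1)) j (1 : ℂ) - Matrix.single j (0 : Fin (h + h + 1)) (1 : ℂ)) p.1 p.2) j 0 = 0)
    (A : Matrix (Fin (h + h + 1)) (Fin (h + h + 1)) ℂ) (hA : Aᵀ = -A) :
    (1 / 2 : ℂ) • ((Matrix.of fun k l => ∑ p : Fin (h + h + 1) × Fin (h + h + 1), X p (k, l) * A p.1 p.2) +
      (Matrix.of fun k l => ∑ p : Fin (h + h + 1) × Fin (h + h + 1), X p (k, l) * A p.1 p.2)ᵀ) = 0 := by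
  suffices hS : (Matrix.of fun k l => ∑ p : Fin (h + h + 1) × Fin (h + h + 1), X p (k, l) * A p.1 p.2) +
      (Matrix.of fun k l => ∑ p : Fin (h + h + 1) × Fin (h + h + 1), X p (k, l) * A p.1 p.2)ᵀ = 0 by
    rw [hS, smul_zero]
  ext k l
  rw [Matrix.add_apply, Matrix.transpose_apply, Matrix.of_apply, Matrix.of_apply, Matrix.zero_apply,
    ← Finset.sum_add_distrib]
  have hc : ∀ a b : Fin (h + h + 1), X (a, b) (k, l) + X (a, b) (l, k) = X (b, a) (k, l) + X (b, a) (l, k) := by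
    intro a b
    have e := linAct_wedge_apply_add_apply_eq_zero hX hf hg a b k l
    rw [linAct_wedge_apply, linAct_wedge_apply] at e
    linear_combination e
  have hAt : ∀ i j : Fin (h + h + 1), A j i = -A i j := fun i j => by
    have e := congrFun (congrFun hA i) j
    rwa [Matrix.transpose_apply, Matrix.neg_apply] at e
  have hsum : ∑ p : Fin (h + h + 1) × Fin (h + h + 1), (X p (k, l) * A p.1 p.2 + X p (l, k) * A p.1 p.2) =
      -∑ p : Fin (h + h + 1) × Fin (h + h + 1), (X p (k, l) * A p.1 p.2 + X p (l, k) * A p.1 p.2) := by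
    conv_lhs => rw [← Equiv.sum_comp (Equiv.prodComm (Fin (h + h + 1)) (Fin (h + h + 1)))]
    rw [← Finset.sum_neg_distrib]
    refine Finset.sum_congr rfl fun p _ => ?_
    rw [Equiv.prodComm_apply, Prod.fst_swap, Prod.snd_swap, hAt p.1 p.2]
    have hcp := hc p.2 p.1
    rw [Prod.swap, show ((p.1, p.2) : Fin (h + h + 1) × Fin (h + h + 1)) = p from rfl] at *
    linear_combination (-A p.1 p.2) * hcp
  linear_combination hsum / 2

/-- **Block (I) in the shape of the assembly's hypothesis `blockI`** (`SkewAdj.LMR2013_prop_3_5_1_of_blocks`,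
`LMR13PLambdaStabilizerAssembly.lean`; stated there for `2 ≤ h`, proved here for every `h`).
[cite: LandsbergManivelRessayre2013, §3.5 (p. 481)] -/
theorem pLambda_blockI : ∀ h : ℕ, 2 ≤ h →
    ∀ X : Matrix (Fin (h + h + 1) × Fin (h + h + 1)) (Fin (h + h + 1) × Fin (h + h + 1)) ℂ,
    X ∈ glAnn (pLambda (h + h + 1)) →
    (∀ a b : Fin (h + h + 1), a ≠ b →
      (Matrix.of fun k l => ∑ p : Fin (h + h + 1) × Fin (h + h + 1), X p (k, l) *
        (Matrix.single a b (1 : ℂ) - Matrix.single b a (1 : ℂ)) p.1 p.2) b b = 0) →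
    (∀ j : Fin (h + h + 1), j ≠ 0 →
      (Matrix.of fun k l => ∑ p : Fin (h + h + 1) × Fin (h + h + 1), X p (k, l) *
          (Matrix.single (0 : Fin (h + h + 1)) j (1 : ℂ) - Matrix.single j (0 : Fin (h + h + 1)) (1 : ℂ)) p.1 p.2) 0 j +
        (Matrix.of fun k l => ∑ p : Fin (h + h + 1) × Fin (h + h + 1), X p (k, l) *
          (Matrix.single (0 : Fin (h + h + 1)) j (1 : ℂ) - Matrix.single j (0 : Fin (h + h + 1)) (1 : ℂ)) p.1 p.2) j 0 = 0) →
    ∀ A : Matrix (Fin (h + h + 1)) (Fin (h + h + 1)) ℂ, Aᵀ = -A →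
      (1 / 2 : ℂ) • ((Matrix.of fun k l => ∑ p : Fin (h + h + 1) × Fin (h + h + 1), X p (k, l) * A p.1 p.2) +
        (Matrix.of fun k l => ∑ p : Fin (h + h + 1) × Fin (h + h + 1), X p (k, l) * A p.1 p.2)ᵀ) = 0 :=
  fun _ _ _ hX hf hg A hA => symPart_linAct_skew_eq_zero hX hf hg A hA

end SkewAdj

end Literature.Computability.AlgebraicComplexity

end
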